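import Summits.QuantumFields.YangMills.Theorems.FluctuationComparisonRegPrIntLS2BetaDistributedHolonomySU2
import HarnessLib

/-!
# S2β · `hFlat` road, brick (ii-a) of UV3-NODE §57.8 — THE GEODESIC JENSEN LIFT ON `SU(2)`: a geodesic convex combination of
# small group elements has ARC `≤` the root-mean of the arcs, EXACTLY (no curvature defect), and the Whitney-type lift of coarse bond
# data over a partition of unity of total mass `Λ` costs EXACTLY `Λ∕L²` in `ℓ²` of arcs

Cell `ym3-torus` (rung R3 = continuum `SU(2)` Yang–Mills on the three-torus — NOT d = 4, NOT infinite volume, NOT a mass gap, NOT Clay).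
Width seat «width 8» `ym3-torus-px8` (gen 21), FREE px helper on crux `stmt-QuantumFields-20520` (`Theses.UnitScaleTilt.FluctuationComparisonRegPrIntL`),
count-neutral, DEFINITION-FREE.  The ARC of `U ∈ SU(2)` is `‖logVec (su2Quat U)‖ ∈ [0, π]` (lit ✓`T4ExpWindowSmallField.logVec`, the rotation half-angle;
the chord is `dist1 U = 2 sin(arc∕2)`, lit ✓`dist1_eq_two_mul_sin`).

WHY (UV3-NODE §57.8 (B), requirement (R1)).  The nonlinear assembly of the depth-uniform flat letter `hFlat` is the recursion
`B_t ≤ √L·B_{t+1} + R_t` over the averaging tower, where `B_t` is the `ℓ²`-norm of the ARCS of the level-`t` averaged field in its final gauge and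
the factor `√L` is the `ℓ²` cost of LIFTING the coarser field by geodesic (Whitney-type) interpolation: a fine bond receives
`expPoint (Σ_e w_e(b) • L⁻¹ • logVec (U(e)))` over the coarse edges `e` of its cube, `w_e(b) ≥ 0`, `Σ_e w_e(b) = 1`, `Σ_b w_e(b) = L³`.  The recursion
sits EXACTLY at UV3-NODE §53.3's criticality, so the lift bound must be an IDENTITY-LEVEL bound: no `(1 + ε)` may appear (it would compound to
`(1+ε)^m`).  In ARC currency it is one: `arc (expPoint v) = ‖v‖` for `‖v‖ ≤ π` (§1) and `‖Σ_e w_e • v_e‖² ≤ Σ_e w_e ‖v_e‖²` (Jensen, §2) — this file.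
(In CHORD currency the root of a bond costs `1 + O(arc²)` per level, which is why §57.8 runs the recursion on arcs and converts to chords once,
at the end: `dist1 ≤ arc`, §1.)

* §1 `norm_logVec_su2Quat_expPoint` (`arc (expPoint v) = ‖v‖` for `‖v‖ ≤ π`), `dist1_le_norm_logVec` (chord `≤` arc), `norm_logVec_su2Quat_expPoint_le` (any `v`).
* §2 `sq_norm_sum_smul_le` (Jensen for `‖·‖²` with convex weights, any real inner-product space), ★ `sq_norm_logVec_expPoint_sum_smul_le`
  (`arc(expPoint(Σ_e w_e • v_e))² ≤ Σ_e w_e ‖v_e‖²`, weights `≥ 0` summing to `1`, members in the closed `π`-ball), ★ its group form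
  `sq_norm_logVec_geodesicMean_le` (`v_e := c • logVec (su2Quat (X e))`, `0 ≤ c ≤ 1`: `arc² ≤ c²·Σ_e w_e·arc(X e)²`).
* §3 ★★ `sum_sq_norm_logVec_lift_le` — THE LIFT INEQUALITY: for fine bonds `b ∈ Bf`, coarse edges `e ∈ Ec`, weights `w b e ≥ 0` with `Σ_e w b e = 1` for
  every `b` and `Σ_b w b e ≤ Λ` for every `e`, and the root factor `c` (`0 ≤ c ≤ 1`, e.g. `c = L⁻¹`):
  `Σ_b arc(expPoint(Σ_e (w b e * c) • logVec (X e)))² ≤ c²·Λ·Σ_e arc(X e)²` — with `Λ = L³`, `c = L⁻¹` this is `‖lift‖² ≤ L·‖coarse‖²` EXACTLY.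

HONEST SCOPE.  Finite sums and the tree's quaternion exponential chart; no lattice, no field, no gauge construction; nothing of Bałaban's analysis; the
recursion of §57.8, `hFlat`, TUBE-REG∘, GAP♯∘ (`stub_uniformFibreGapOrbit`), S2β, crux 20520 and `YM3TorusSU2` are NOT proved; no registered stub is
closed; the Yang–Mills mass gap is NOT proved.
References: T. Bałaban, CMP **99** (1985) 75–102 [Balaban1985RegularSpaces] ((1.29) p.81, (1.36) p.82); CMP **96** (1984) 223–250 [Balaban1984PropagatorsII] ((1.33)).
-/

set_option autoImplicit false

noncomputable section

namespace Summit.QuantumFields.YangMills.Theorems.FluctuationComparisonRegPrIntLS2BetaGeodesicJensenLift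

open scoped Real RealInnerProductSpace BigOperators
open Literature.MathematicalPhysics.QuantumLattice (su2Quat norm_su2Quat)
open Literature.MathematicalPhysics.QuantumFieldTheory.Balaban1983to89
open T4CubeChartGnomonic (SU2)
open T4HaarSU2ExpChart (expPoint su2Quat_expPoint exp_imQuat_re)
open T4ExpWindowSmallField (logVec norm_logVec norm_logVec_le_pi expPoint_logVec dist1_expPoint_le dist1_eq_two_mul_sin)

/-! ## §1 Arc and chord on `SU(2)` -/

/-- **THE ARC OF `expPoint v` IS `‖v‖`** on the closed `π`-ball: `‖logVec (su2Quat (expPoint v))‖ = ‖v‖` for `‖v‖ ≤ π`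
(`‖logVec q‖ = arccos (re q)` and `re (exp ι v) = cos ‖v‖`). [folklore] -/
theorem norm_logVec_su2Quat_expPoint {v : EuclideanSpace ℝ (Fin 3)} (hv : ‖v‖ ≤ π) :
    ‖logVec (su2Quat (expPoint v))‖ = ‖v‖ := by
  rw [norm_logVec, su2Quat_expPoint, exp_imQuat_re, Real.arccos_cos (norm_nonneg v) hv]

/-- For every `v`: `‖logVec (su2Quat (expPoint v))‖ ≤ ‖v‖` (on the `π`-ball this is §1's equality; beyond it the left side is `≤ π < ‖v‖`). [folklore] -/
theorem norm_logVec_su2Quat_expPoint_le (v : EuclideanSpace ℝ (Fin 3)) :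
    ‖logVec (su2Quat (expPoint v))‖ ≤ ‖v‖ := by
  rcases le_or_gt ‖v‖ π with h | h
  · exact (norm_logVec_su2Quat_expPoint h).le
  · exact (norm_logVec_le_pi _).trans h.le

/-- **CHORD ≤ ARC**: `dist1 U ≤ ‖logVec (su2Quat U)‖` (`U = expPoint (logVec …)` and lit ✓`dist1_expPoint_le`). [folklore] -/
theorem dist1_le_norm_logVec (U : SU2) : dist1 U ≤ ‖logVec (su2Quat U)‖ := by
  conv_lhs => rw [← expPoint_logVec U]
  exact dist1_expPoint_le _

/-! ## §2 Jensen for `‖·‖²` with convex weights, and the geodesic convex combination -/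

/-- **JENSEN FOR THE SQUARED NORM** (any real inner-product space): for weights `w i ≥ 0` with `Σ_{i∈s} w i = 1`,
`‖Σ_{i∈s} w i • v i‖² ≤ Σ_{i∈s} w i * ‖v i‖²` (triangle inequality, then the weighted Cauchy–Schwarz `(Σ w a)² ≤ (Σ w)(Σ w a²)`). [folklore] -/
theorem sq_norm_sum_smul_le {E : Type*} [NormedAddCommGroup E] [NormedSpace ℝ E] {ι : Type*} (s : Finset ι)
    {w : ι → ℝ} (hw0 : ∀ i ∈ s, 0 ≤ w i) (hw1 : ∑ i ∈ s, w i = 1) (v : ι → E) :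
    ‖∑ i ∈ s, w i • v i‖ ^ 2 ≤ ∑ i ∈ s, w i * ‖v i‖ ^ 2 := by
  have htri : ‖∑ i ∈ s, w i • v i‖ ≤ ∑ i ∈ s, w i * ‖v i‖ := by
    refine (norm_sum_le _ _).trans (le_of_eq (Finset.sum_congr rfl fun i hi => ?_))
    rw [norm_smul, Real.norm_eq_abs, abs_of_nonneg (hw0 i hi)]
  have h0 : 0 ≤ ∑ i ∈ s, w i * ‖v i‖ := Finset.sum_nonneg fun i hi => mul_nonneg (hw0 i hi) (norm_nonneg _)
  -- weighted Cauchy–Schwarz: (Σ w a)² = (Σ √w · √w a)² ≤ (Σ w) (Σ w a²)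
  have hcs : (∑ i ∈ s, w i * ‖v i‖) ^ 2 ≤ (∑ i ∈ s, w i) * ∑ i ∈ s, w i * ‖v i‖ ^ 2 := by
    have h := Finset.sum_mul_sq_le_sq_mul_sq s (fun i => Real.sqrt (w i)) (fun i => Real.sqrt (w i) * ‖v i‖)
    have e1 : ∑ i ∈ s, Real.sqrt (w i) * (Real.sqrt (w i) * ‖v i‖) = ∑ i ∈ s, w i * ‖v i‖ :=
      Finset.sum_congr rfl fun i hi => by rw [← mul_assoc, Real.mul_self_sqrt (hw0 i hi)]
    have e2 : ∑ i ∈ s, Real.sqrt (w i) ^ 2 = ∑ i ∈ s, w i :=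
      Finset.sum_congr rfl fun i hi => Real.sq_sqrt (hw0 i hi)
    have e3 : ∑ i ∈ s, (Real.sqrt (w i) * ‖v i‖) ^ 2 = ∑ i ∈ s, w i * ‖v i‖ ^ 2 :=
      Finset.sum_congr rfl fun i hi => by rw [mul_pow, Real.sq_sqrt (hw0 i hi)]
    rwa [e1, e2, e3] at h
  calc ‖∑ i ∈ s, w i • v i‖ ^ 2 ≤ (∑ i ∈ s, w i * ‖v i‖) ^ 2 := by gcongr
    _ ≤ (∑ i ∈ s, w i) * ∑ i ∈ s, w i * ‖v i‖ ^ 2 := hcs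
    _ = ∑ i ∈ s, w i * ‖v i‖ ^ 2 := by rw [hw1, one_mul]

/-- A convex combination of vectors of norm `≤ r` has norm `≤ r`. [folklore] -/
theorem norm_sum_smul_le_of_forall_le {E : Type*} [NormedAddCommGroup E] [NormedSpace ℝ E] {ι : Type*} (s : Finset ι)
    {w : ι → ℝ} (hw0 : ∀ i ∈ s, 0 ≤ w i) (hw1 : ∑ i ∈ s, w i = 1) {v : ι → E} {r : ℝ} (hv : ∀ i ∈ s, ‖v i‖ ≤ r) :
    ‖∑ i ∈ s, w i • v i‖ ≤ r := by
  calc ‖∑ i ∈ s, w i • v i‖ ≤ ∑ i ∈ s, w i * ‖v i‖ := by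
        refine (norm_sum_le _ _).trans (le_of_eq (Finset.sum_congr rfl fun i hi => ?_))
        rw [norm_smul, Real.norm_eq_abs, abs_of_nonneg (hw0 i hi)]
    _ ≤ ∑ i ∈ s, w i * r := Finset.sum_le_sum fun i hi => mul_le_mul_of_nonneg_left (hv i hi) (hw0 i hi)
    _ = r := by rw [← Finset.sum_mul, hw1, one_mul]

/-- ★ **THE GEODESIC CONVEX COMBINATION IS JENSEN-EXACT IN ARC**: for weights `w i ≥ 0`, `Σ_{i∈s} w i = 1`, and Lie-algebra vectors `v i`,
`‖logVec (su2Quat (expPoint (Σ_{i∈s} w i • v i)))‖² ≤ Σ_{i∈s} w i * ‖v i‖²` — no curvature defect (the arc of `expPoint` never exceeds the norm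
of its argument, §1, then Jensen). [folklore] -/
theorem sq_norm_logVec_expPoint_sum_smul_le {ι : Type*} (s : Finset ι) {w : ι → ℝ} (hw0 : ∀ i ∈ s, 0 ≤ w i)
    (hw1 : ∑ i ∈ s, w i = 1) (v : ι → EuclideanSpace ℝ (Fin 3)) :
    ‖logVec (su2Quat (expPoint (∑ i ∈ s, w i • v i)))‖ ^ 2 ≤ ∑ i ∈ s, w i * ‖v i‖ ^ 2 :=
  (pow_le_pow_left₀ (norm_nonneg _) (norm_logVec_su2Quat_expPoint_le _) 2).trans (sq_norm_sum_smul_le s hw0 hw1 v)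

/-- ★ **GROUP FORM — THE GEODESIC MEAN OF ROOTS**: for group elements `X i`, weights `w i ≥ 0` summing to `1` and a root factor `0 ≤ c` (e.g. `c = L⁻¹`,
the `L`-th root), the element `expPoint (Σ_i w i • c • logVec (su2Quat (X i)))` has `arc² ≤ c²·Σ_i w i·arc(X i)²`. [folklore] -/
theorem sq_norm_logVec_geodesicMean_le {ι : Type*} (s : Finset ι) {w : ι → ℝ} (hw0 : ∀ i ∈ s, 0 ≤ w i)
    (hw1 : ∑ i ∈ s, w i = 1) (X : ι → SU2) (c : ℝ) :
    ‖logVec (su2Quat (expPoint (∑ i ∈ s, w i • (c • logVec (su2Quat (X i))))))‖ ^ 2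
      ≤ c ^ 2 * ∑ i ∈ s, w i * ‖logVec (su2Quat (X i))‖ ^ 2 := by
  refine (sq_norm_logVec_expPoint_sum_smul_le s hw0 hw1 _).trans (le_of_eq ?_)
  rw [Finset.mul_sum]
  refine Finset.sum_congr rfl fun i _ => ?_
  rw [norm_smul, mul_pow, Real.norm_eq_abs, sq_abs]; ring

/-! ## §3 The lift inequality over a partition of unity -/

/-- ★★ **THE LIFT INEQUALITY (requirement (R1) of UV3-NODE §57.8)**: fine bonds `b ∈ Bf`, coarse edges `e ∈ Ec`, weights `w b e ≥ 0` with
`Σ_{e∈Ec} w b e = 1` for every `b ∈ Bf` (partition of unity on each fine bond) and `Σ_{b∈Bf} w b e ≤ Λ` for every `e ∈ Ec` (total mass of one coarse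
edge's hat), root factor `c`: the lifted bond variables `lift b := expPoint (Σ_e (w b e) • c • logVec (su2Quat (X e)))` satisfy
`Σ_{b∈Bf} arc(lift b)² ≤ c²·Λ·Σ_{e∈Ec} arc(X e)²`.  With the Whitney weights of one averaging step (`Λ = L³`, `c = L⁻¹`): `‖lift‖² ≤ L·‖coarse‖²` EXACTLY —
the per-level factor `√L` of the recursion `B_t ≤ √L·B_{t+1} + R_t`, met as an identity-level bound. [cite: Balaban1985RegularSpaces, (1.29) p.81] -/
theorem sum_sq_norm_logVec_lift_le {β ε : Type*} (Bf : Finset β) (Ec : Finset ε) (w : β → ε → ℝ)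
    (hw0 : ∀ b ∈ Bf, ∀ e ∈ Ec, 0 ≤ w b e) (hw1 : ∀ b ∈ Bf, ∑ e ∈ Ec, w b e = 1)
    {Λ : ℝ} (hwΛ : ∀ e ∈ Ec, ∑ b ∈ Bf, w b e ≤ Λ) (X : ε → SU2) (c : ℝ) :
    ∑ b ∈ Bf, ‖logVec (su2Quat (expPoint (∑ e ∈ Ec, w b e • (c • logVec (su2Quat (X e))))))‖ ^ 2
      ≤ c ^ 2 * Λ * ∑ e ∈ Ec, ‖logVec (su2Quat (X e))‖ ^ 2 := by
  calc ∑ b ∈ Bf, ‖logVec (su2Quat (expPoint (∑ e ∈ Ec, w b e • (c • logVec (su2Quat (X e))))))‖ ^ 2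
      ≤ ∑ b ∈ Bf, c ^ 2 * ∑ e ∈ Ec, w b e * ‖logVec (su2Quat (X e))‖ ^ 2 :=
        Finset.sum_le_sum fun b hb => sq_norm_logVec_geodesicMean_le Ec (hw0 b hb) (hw1 b hb) X c
    _ = c ^ 2 * ∑ e ∈ Ec, (∑ b ∈ Bf, w b e) * ‖logVec (su2Quat (X e))‖ ^ 2 := by
        rw [← Finset.mul_sum, Finset.sum_comm]
        congr 1
        refine Finset.sum_congr rfl fun e _ => ?_
        rw [Finset.sum_mul]
    _ ≤ c ^ 2 * ∑ e ∈ Ec, Λ * ‖logVec (su2Quat (X e))‖ ^ 2 := by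
        refine mul_le_mul_of_nonneg_left (Finset.sum_le_sum fun e he => ?_) (sq_nonneg c)
        exact mul_le_mul_of_nonneg_right (hwΛ e he) (sq_nonneg _)
    _ = c ^ 2 * Λ * ∑ e ∈ Ec, ‖logVec (su2Quat (X e))‖ ^ 2 := by rw [← Finset.mul_sum, mul_assoc]

/-- The same with the members' arcs bounded and the lift read as «arc ≤ c · (max arc)» bondwise — the sup companion of §3 (a convex combination of
vectors of norm `≤ c·r` has norm `≤ c·r`). [folklore] -/
theorem norm_logVec_lift_le_of_forall_le {ε : Type*} (Ec : Finset ε) {w : ε → ℝ} (hw0 : ∀ e ∈ Ec, 0 ≤ w e) (hw1 : ∑ e ∈ Ec, w e = 1)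
    (X : ε → SU2) {c r : ℝ} (hc : 0 ≤ c) (hr : ∀ e ∈ Ec, ‖logVec (su2Quat (X e))‖ ≤ r) :
    ‖logVec (su2Quat (expPoint (∑ e ∈ Ec, w e • (c • logVec (su2Quat (X e))))))‖ ≤ c * r := by
  refine (norm_logVec_su2Quat_expPoint_le _).trans (norm_sum_smul_le_of_forall_le Ec hw0 hw1 fun e he => ?_)
  rw [norm_smul, Real.norm_eq_abs, abs_of_nonneg hc]
  exact mul_le_mul_of_nonneg_left (hr e he) hc

end Summit.QuantumFields.YangMills.Theorems.FluctuationComparisonRegPrIntLS2BetaGeodesicJensenLift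

end
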